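import Summits.KontsevichZagierPeriods.Zeta5Search.Certificates.RecordRayDenominatorsCells
import Summits.KontsevichZagierPeriods.Zeta5Search.Zeta3LawWindow
import HarnessLib

/-!
# ζ(5) search — the record ray's DENOMINATORS, VIII: the `(WV)`-law windows `(12n, 16n]` (TYPER g15)

HONEST FRAMING: systematic search; no irrationality claim unless certified.

OUR work (Summit side; typer seat, generation 15).  Below the big-prime range `p > 16n` of files III/IV the sharp integrality
of `U, W` is lost, but the PROVED window form of the ζ(3)-coefficient valuation law
(`ClusterValuation.zeta3CoefficientValuationLaw_window`: `v_p(W(b)) ≥ min(1,⌊(d+1)/p⌋) + a_p(b) − N_p(b)` for `p ≥ 5`,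
`p² > b₀ + 2`) together with the `(V)`-floor law (`constantTermFloorLaw_window`: `v_p(V(b)) ≥ −N_p(b)`) still leaves
`p`-power divisibility of the multiplied coefficients `z_W = d³N♯W`, `z_V = d⁶N♯V` on the record ray for `12n < p ≤ 16n`:

| window        | `v_p(N♯)` | `a_p ≥` | `N_p ≤` | `v_p(W) ≥` | `v_p(z_W) ≥` | `v_p(z_V) ≥` | exponent |
|---------------|-----------|---------|---------|------------|--------------|--------------|----------|
| `(12n, 13n]`  | `3`       | `6`     | `12`    | `−5`       | `1`          | `0`          | `1`      |
| `(13n, 14n]`  | `1`       | `5`     | `9`     | `−3`       | `1`          | `0`          | `1`      |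
| `(14n, 15n]`  | `−1`      | `4`     | `6`     | `−1`       | `1`          | `0`          | `1`      |
| `(15n, 16n]`  | `−1`      | `3`     | `4`     | `0`        | `2`          | `1`          | `3`      |

(the wedge `z_{W′}z_V − z_W z_{V′}` and the Q-minor `d⁵(z_U z_{W′} − z_{U′} z_W)` are divisible by `p^k`,
`k = min(v(z_{W′}) + v(z_V), 5 + v(z_W))`; `law_core`).  Rate gained in file IX: `1 + 1 + 1 + 3 = 6`.
Valuation bookkeeping only: `bMin`, `a_p`, `N_p`, the refund on the ray, and the four window lemmas `wLaw0–3`.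
-/

noncomputable section

open Finset

namespace Summit.KontsevichZagierPeriods.Zeta5Search.RecordRay

open Summit.KontsevichZagierPeriods.Zeta5Search.DualSeries
open Summit.KontsevichZagierPeriods.Zeta5Search.DualSeriesDenominators
open Summit.KontsevichZagierPeriods.Zeta5Search.WedgeDictionary
open Summit.KontsevichZagierPeriods.Zeta5Search.DualSeriesLemma19 (bRecord)
open Summit.KontsevichZagierPeriods.Zeta5Search.CasoratianValuation (InPolytope pairFloors bMin topPartners refundW)
open Summit.KontsevichZagierPeriods.Zeta5Search.ClusterValuation (lawW zeta3CoefficientValuationLaw_window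
  constantTermFloorLaw_window)

/-! ### Generic divisibility bookkeeping -/

/-- `p ∣ d_{41n}` for a prime `p ≤ 41n`. -/
theorem natCast_dvd_lcmUpto41 {n p : ℕ} (hp : p.Prime) (hp41 : p ≤ 41 * n) : (p : ℤ) ∣ (Nat.lcmUpto (41 * n) : ℤ) := by
  rw [Int.natCast_dvd_natCast, Nat.lcmUpto]
  exact Finset.dvd_lcm (Finset.mem_Icc.2 ⟨hp.one_lt.le, hp41⟩)

/-- **One multiplied coefficient.**  If `z = d^e·N♯(b)·C ∈ ℤ` with `v_p(N♯(b)) = vN`, `C ≠ 0 → L ≤ v_p(C)`, and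
`v_p(d_{41n}) = 1` (`p ≤ 41n < p²`), then `p^k ∣ z` for every `k ≤ e + vN + L`. -/
theorem dvd_zterm {n p : ℕ} (hp : p.Prime) (hp41 : p ≤ 41 * n) (hsq : 41 * n < p ^ 2) {b : ℕ → ℤ} {C : ℚ} {e : ℕ}
    {vN L : ℤ} {z : ℤ} (hvN : padicValRat p (sharpNormaliser b) = vN) (hC : C ≠ 0 → L ≤ padicValRat p C)
    (hz : dRec n ^ e * sharpNormaliser b * C = z) {k : ℕ} (hk : (k : ℤ) ≤ e + vN + L) : (p : ℤ) ^ k ∣ z := by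
  haveI := Fact.mk hp
  by_cases h0 : C = 0
  · have : z = 0 := by have := hz; rw [h0, mul_zero] at this; exact_mod_cast this.symm
    rw [this]; exact dvd_zero _
  have hd : dRec n ≠ 0 := (dRec_pos n).ne'
  have hN : sharpNormaliser b ≠ 0 := (sharpNormaliser_pos _).ne'
  have hz0 : (z : ℚ) ≠ 0 := by rw [← hz]; exact mul_ne_zero (mul_ne_zero (pow_ne_zero _ hd) hN) h0
  have hz0' : z ≠ 0 := by exact_mod_cast hz0
  have hdv : padicValRat p (dRec n) = 1 := by
    unfold dRec; rw [padicValRat.of_nat]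
    exact_mod_cast Literature.NumberTheory.Transcendental.Zudilin2004.padicValNat_lcmUpto_eq_one hp41 hsq
  rw [padicValInt_dvd_iff]; right
  have hval : ((padicValInt p z : ℕ) : ℤ) = e + vN + padicValRat p C := by
    rw [← padicValRat.of_int, ← hz, padicValRat.mul (mul_ne_zero (pow_ne_zero _ hd) hN) h0,
      padicValRat.mul (pow_ne_zero _ hd) hN, padicValRat.pow, hdv, hvN]
    ring
  have := hC h0
  have : (k : ℤ) ≤ ((padicValInt p z : ℕ) : ℤ) := by rw [hval]; linarith
  exact_mod_cast this

/-- **The window core below `16n`.**  From `p^{kW} ∣ z_W`, `p^{kW′} ∣ z_{W′}`, `p^{kV} ∣ z_V`, `p^{kV′} ∣ z_{V′}` and `p ∣ D`: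
`p^k` divides `z_{W′}z_V − z_W z_{V′}` and `D⁵(z_U z_{W′} − z_{U′} z_W)` for `k ≤ kW′ + kV, kW + kV′, 5 + kW′, 5 + kW`. -/
theorem law_core {p : ℕ} {D zW zV zW' zV' zU zU' : ℤ} (hD : (p : ℤ) ∣ D) {kW kW' kV kV' k : ℕ}
    (hW : (p : ℤ) ^ kW ∣ zW) (hW' : (p : ℤ) ^ kW' ∣ zW') (hV : (p : ℤ) ^ kV ∣ zV) (hV' : (p : ℤ) ^ kV' ∣ zV')
    (h1 : k ≤ kW' + kV) (h2 : k ≤ kW + kV') (h3 : k ≤ 5 + kW') (h4 : k ≤ 5 + kW) :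
    (p : ℤ) ^ k ∣ (zW' * zV - zW * zV') ∧ (p : ℤ) ^ k ∣ (D ^ 5 * (zU * zW') - D ^ 5 * (zU' * zW)) := by
  have hD5 : (p : ℤ) ^ 5 ∣ D ^ 5 := pow_dvd_pow_of_dvd hD 5
  refine ⟨dvd_sub ?_ ?_, dvd_sub ?_ ?_⟩
  · exact (pow_dvd_pow _ h1).trans (by rw [pow_add]; exact mul_dvd_mul hW' hV)
  · exact (pow_dvd_pow _ h2).trans (by rw [pow_add]; exact mul_dvd_mul hW hV')
  · exact (pow_dvd_pow _ h3).trans (by rw [pow_add]; exact mul_dvd_mul hD5 (dvd_mul_of_dvd_right hW' zU))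
  · exact (pow_dvd_pow _ h4).trans (by rw [pow_add]; exact mul_dvd_mul hD5 (dvd_mul_of_dvd_right hW zU'))

/-! ### The law's ingredients on the ray: `bMin`, `a_p`, the refund, `N_p` -/

/-- `bMin (bRecord n) = 11n`. -/
theorem bMin_bRecord (n : ℕ) : bMin (bRecord n) = 11 * n := by
  obtain ⟨h0, h1, h2, h3, h4, h5, h6, h7⟩ := bRecord_vals n
  unfold bMin
  apply le_antisymm
  · exact Finset.min'_le _ _ (mem_image.2 ⟨6, by simp, by rw [h7]⟩)
  · apply Finset.le_min'
    intro x hx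
    obtain ⟨i, hi, rfl⟩ := mem_image.1 hx
    have : i < 7 := mem_range.1 hi
    interval_cases i <;> simp [h1, h2, h3, h4, h5, h6, h7] <;> omega

/-- `bMin (bRecord' n) = 11n + 1` (`n ≥ 1`). -/
theorem bMin_bRecord' {n : ℕ} (hn : 1 ≤ n) : bMin (bRecord' n) = 11 * n + 1 := by
  obtain ⟨h0, h1, h2, h3, h4, h5, h6, h7⟩ := bRecord'_vals n
  unfold bMin
  apply le_antisymm
  · exact Finset.min'_le _ _ (mem_image.2 ⟨6, by simp, by rw [h7]⟩)
  · apply Finset.le_min'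
    intro x hx
    obtain ⟨i, hi, rfl⟩ := mem_image.1 hx
    have : i < 7 := mem_range.1 hi
    interval_cases i <;> simp [h1, h2, h3, h4, h5, h6, h7] <;> omega

/-- `a_p(bRecord n) ≥ |S| − 1` whenever the thresholds `b₀ − b_{i+1} − 11n`, `i ∈ S`, are all `≥ p`. -/
theorem topPartners_bRecord_ge (n p : ℕ) (S : Finset ℕ) (hS : S ⊆ range 7)
    (h : ∀ i ∈ S, (p : ℤ) ≤ bRecord n 0 - bRecord n (i + 1) - 11 * n) :
    (S.card : ℤ) - 1 ≤ topPartners (bRecord n) p := by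
  unfold topPartners
  rw [bMin_bRecord]
  have hsub : S ⊆ (range 7).filter (fun i => (p : ℤ) ≤ bRecord n 0 - bRecord n (i + 1) - 11 * n) := by
    intro i hi
    exact mem_filter.2 ⟨hS hi, h i hi⟩
  have hc := Finset.card_le_card hsub
  have : (if (p : ℤ) ≤ bRecord n 0 - 2 * (11 * n) then (1 : ℤ) else 0) ≤ 1 := by split_ifs <;> norm_num
  omega

/-- `a_p(bRecord' n) ≥ |S| − 1` whenever the thresholds `b′₀ − b′_{i+1} − (11n+1)`, `i ∈ S`, are all `≥ p` (`n ≥ 1`). -/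
theorem topPartners_bRecord'_ge {n : ℕ} (hn : 1 ≤ n) (p : ℕ) (S : Finset ℕ) (hS : S ⊆ range 7)
    (h : ∀ i ∈ S, (p : ℤ) ≤ bRecord' n 0 - bRecord' n (i + 1) - (11 * n + 1)) :
    (S.card : ℤ) - 1 ≤ topPartners (bRecord' n) p := by
  unfold topPartners
  rw [bMin_bRecord' hn]
  have hsub : S ⊆ (range 7).filter (fun i => (p : ℤ) ≤ bRecord' n 0 - bRecord' n (i + 1) - (11 * n + 1)) := by
    intro i hi
    exact mem_filter.2 ⟨hS hi, h i hi⟩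
  have hc := Finset.card_le_card hsub
  have : (if (p : ℤ) ≤ bRecord' n 0 - 2 * (11 * n + 1) then (1 : ℤ) else 0) ≤ 1 := by split_ifs <;> norm_num
  omega

/-- The refund is `1` on the ray for `p ≤ 25n + 1` (`d(b) = 25n`). -/
theorem refundW_bRecord {n p : ℕ} (hp0 : 0 < p) (h : p ≤ 25 * n + 1) : refundW (bRecord n) p = 1 := by
  unfold refundW
  rw [dOf_bRecord]
  apply min_eq_left
  rw [Int.le_ediv_iff_mul_le (by exact_mod_cast hp0)]
  have : (p : ℤ) ≤ 25 * n + 1 := by exact_mod_cast h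
  linarith

/-- The refund is `1` at the partner for `p ≤ 25n` (`d(b′) = 25n − 1`). -/
theorem refundW_bRecord' {n p : ℕ} (hp0 : 0 < p) (h : p ≤ 25 * n) : refundW (bRecord' n) p = 1 := by
  unfold refundW
  rw [dOf_bRecord']
  apply min_eq_left
  rw [Int.le_ediv_iff_mul_le (by exact_mod_cast hp0)]
  have : (p : ℤ) ≤ 25 * n := by exact_mod_cast h
  linarith

/-- `⌊z/p⌋ ≤ [p ≤ c·n]` when `z ≤ c·n < 2p`. -/
theorem ediv_le_ind {z : ℤ} {p c n : ℕ} (hp0 : 0 < p) (hz : z ≤ (c : ℤ) * n) (h2 : (c : ℤ) * n < 2 * p) :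
    z / (p : ℤ) ≤ (if p ≤ c * n then 1 else 0 : ℤ) := by
  have hp0' : (0 : ℤ) < p := by exact_mod_cast hp0
  split_ifs with h
  · exact ediv_le_of_lt hp0' 1 (by linarith)
  · have : ((c * n : ℕ) : ℤ) < p := by exact_mod_cast not_le.1 h
    push_cast at this
    exact ediv_le_of_lt hp0' 0 (by linarith)

/-- The pair-floor profile of the ray for `p > 12n`: `3[p ≤ 13n] + 3[p ≤ 14n] + 2[p ≤ 15n] + 2[p ≤ 16n] + [p ≤ 17n] + [p ≤ 18n]`
(multiplicities of the block lengths `13n,…,18n` among the 21 blocks `(41 − β_i − β_k)n`; blocks `≤ 12n` hold no multiple). -/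
def pfLaw (n p : ℕ) : ℤ :=
  3 * (if p ≤ 13 * n then 1 else 0 : ℤ) + 3 * (if p ≤ 14 * n then 1 else 0 : ℤ) + 2 * (if p ≤ 15 * n then 1 else 0 : ℤ) +
    2 * (if p ≤ 16 * n then 1 else 0 : ℤ) + (if p ≤ 17 * n then 1 else 0 : ℤ) + (if p ≤ 18 * n then 1 else 0 : ℤ)

set_option maxHeartbeats 800000 in
/-- `N_p(bRecord n) ≤ pfLaw n p` for `p > 12n`. -/
theorem pairFloors_bRecord_le_pfLaw {n p : ℕ} (hp0 : 0 < p) (hp : 12 * n < p) : pairFloors (bRecord n) p ≤ pfLaw n p := by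
  obtain ⟨h0, h1, h2, h3, h4, h5, h6, h7⟩ := bRecord_vals n
  have hp0' : (0 : ℤ) < p := by exact_mod_cast hp0
  simp only [pairFloors, sum_range_succ, sum_range_zero, zero_add, h0, h1, h2, h3, h4, h5, h6, h7]
  norm_num
  unfold pfLaw
  have hpZ : (12 * n : ℤ) < p := by exact_mod_cast hp
  -- keep `hp0` in play for `ediv_le_ind`
  have t0 : ((41 : ℤ) * n - 17 * n - 16 * n) / p ≤ 0 := ediv_le_of_lt hp0' 0 (by linarith)
  have t1 : ((41 : ℤ) * n - 17 * n - 15 * n) / p ≤ 0 := ediv_le_of_lt hp0' 0 (by linarith)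
  have t2 : ((41 : ℤ) * n - 17 * n - 14 * n) / p ≤ 0 := ediv_le_of_lt hp0' 0 (by linarith)
  have t3 : ((41 : ℤ) * n - 17 * n - 13 * n) / p ≤ 0 := ediv_le_of_lt hp0' 0 (by linarith)
  have t4 : ((41 : ℤ) * n - 17 * n - 12 * n) / p ≤ 0 := ediv_le_of_lt hp0' 0 (by linarith)
  have t5 : ((41 : ℤ) * n - 17 * n - 11 * n) / p ≤ (if p ≤ 13 * n then 1 else 0 : ℤ) := ediv_le_ind hp0 (by push_cast; linarith) (by push_cast; linarith)
  have t6 : ((41 : ℤ) * n - 16 * n - 15 * n) / p ≤ 0 := ediv_le_of_lt hp0' 0 (by linarith)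
  have t7 : ((41 : ℤ) * n - 16 * n - 14 * n) / p ≤ 0 := ediv_le_of_lt hp0' 0 (by linarith)
  have t8 : ((41 : ℤ) * n - 16 * n - 13 * n) / p ≤ 0 := ediv_le_of_lt hp0' 0 (by linarith)
  have t9 : ((41 : ℤ) * n - 16 * n - 12 * n) / p ≤ (if p ≤ 13 * n then 1 else 0 : ℤ) := ediv_le_ind hp0 (by push_cast; linarith) (by push_cast; linarith)
  have t10 : ((41 : ℤ) * n - 16 * n - 11 * n) / p ≤ (if p ≤ 14 * n then 1 else 0 : ℤ) := ediv_le_ind hp0 (by push_cast; linarith) (by push_cast; linarith)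
  have t11 : ((41 : ℤ) * n - 15 * n - 14 * n) / p ≤ 0 := ediv_le_of_lt hp0' 0 (by linarith)
  have t12 : ((41 : ℤ) * n - 15 * n - 13 * n) / p ≤ (if p ≤ 13 * n then 1 else 0 : ℤ) := ediv_le_ind hp0 (by push_cast; linarith) (by push_cast; linarith)
  have t13 : ((41 : ℤ) * n - 15 * n - 12 * n) / p ≤ (if p ≤ 14 * n then 1 else 0 : ℤ) := ediv_le_ind hp0 (by push_cast; linarith) (by push_cast; linarith)
  have t14 : ((41 : ℤ) * n - 15 * n - 11 * n) / p ≤ (if p ≤ 15 * n then 1 else 0 : ℤ) := ediv_le_ind hp0 (by push_cast; linarith) (by push_cast; linarith)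
  have t15 : ((41 : ℤ) * n - 14 * n - 13 * n) / p ≤ (if p ≤ 14 * n then 1 else 0 : ℤ) := ediv_le_ind hp0 (by push_cast; linarith) (by push_cast; linarith)
  have t16 : ((41 : ℤ) * n - 14 * n - 12 * n) / p ≤ (if p ≤ 15 * n then 1 else 0 : ℤ) := ediv_le_ind hp0 (by push_cast; linarith) (by push_cast; linarith)
  have t17 : ((41 : ℤ) * n - 14 * n - 11 * n) / p ≤ (if p ≤ 16 * n then 1 else 0 : ℤ) := ediv_le_ind hp0 (by push_cast; linarith) (by push_cast; linarith)
  have t18 : ((41 : ℤ) * n - 13 * n - 12 * n) / p ≤ (if p ≤ 16 * n then 1 else 0 : ℤ) := ediv_le_ind hp0 (by push_cast; linarith) (by push_cast; linarith)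
  have t19 : ((41 : ℤ) * n - 13 * n - 11 * n) / p ≤ (if p ≤ 17 * n then 1 else 0 : ℤ) := ediv_le_ind hp0 (by push_cast; linarith) (by push_cast; linarith)
  have t20 : ((41 : ℤ) * n - 12 * n - 11 * n) / p ≤ (if p ≤ 18 * n then 1 else 0 : ℤ) := ediv_le_ind hp0 (by push_cast; linarith) (by push_cast; linarith)
  linarith

set_option maxHeartbeats 800000 in
/-- `N_p(bRecord' n) ≤ pfLaw n p` for `p > 12n`. -/
theorem pairFloors_bRecord'_le_pfLaw {n p : ℕ} (hp0 : 0 < p) (hp : 12 * n < p) : pairFloors (bRecord' n) p ≤ pfLaw n p := by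
  obtain ⟨h0, h1, h2, h3, h4, h5, h6, h7⟩ := bRecord'_vals n
  have hp0' : (0 : ℤ) < p := by exact_mod_cast hp0
  simp only [pairFloors, sum_range_succ, sum_range_zero, zero_add, h0, h1, h2, h3, h4, h5, h6, h7]
  norm_num
  unfold pfLaw
  have hpZ : (12 * n : ℤ) < p := by exact_mod_cast hp
  have t0 : ((41 : ℤ) * n - 17 * n - 16 * n) / p ≤ 0 := ediv_le_of_lt hp0' 0 (by linarith)
  have t1 : ((41 : ℤ) * n - 17 * n - 15 * n) / p ≤ 0 := ediv_le_of_lt hp0' 0 (by linarith)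
  have t2 : ((41 : ℤ) * n - 17 * n - 14 * n) / p ≤ 0 := ediv_le_of_lt hp0' 0 (by linarith)
  have t3 : ((41 : ℤ) * n - 17 * n - 13 * n) / p ≤ 0 := ediv_le_of_lt hp0' 0 (by linarith)
  have t4 : ((41 : ℤ) * n - 17 * n - 12 * n) / p ≤ 0 := ediv_le_of_lt hp0' 0 (by linarith)
  have t5 : ((41 : ℤ) * n - 17 * n - (11 * n + 1)) / p ≤ (if p ≤ 13 * n then 1 else 0 : ℤ) := ediv_le_ind hp0 (by push_cast; linarith) (by push_cast; linarith)
  have t6 : ((41 : ℤ) * n - 16 * n - 15 * n) / p ≤ 0 := ediv_le_of_lt hp0' 0 (by linarith)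
  have t7 : ((41 : ℤ) * n - 16 * n - 14 * n) / p ≤ 0 := ediv_le_of_lt hp0' 0 (by linarith)
  have t8 : ((41 : ℤ) * n - 16 * n - 13 * n) / p ≤ 0 := ediv_le_of_lt hp0' 0 (by linarith)
  have t9 : ((41 : ℤ) * n - 16 * n - 12 * n) / p ≤ (if p ≤ 13 * n then 1 else 0 : ℤ) := ediv_le_ind hp0 (by push_cast; linarith) (by push_cast; linarith)
  have t10 : ((41 : ℤ) * n - 16 * n - (11 * n + 1)) / p ≤ (if p ≤ 14 * n then 1 else 0 : ℤ) := ediv_le_ind hp0 (by push_cast; linarith) (by push_cast; linarith)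
  have t11 : ((41 : ℤ) * n - 15 * n - 14 * n) / p ≤ 0 := ediv_le_of_lt hp0' 0 (by linarith)
  have t12 : ((41 : ℤ) * n - 15 * n - 13 * n) / p ≤ (if p ≤ 13 * n then 1 else 0 : ℤ) := ediv_le_ind hp0 (by push_cast; linarith) (by push_cast; linarith)
  have t13 : ((41 : ℤ) * n - 15 * n - 12 * n) / p ≤ (if p ≤ 14 * n then 1 else 0 : ℤ) := ediv_le_ind hp0 (by push_cast; linarith) (by push_cast; linarith)
  have t14 : ((41 : ℤ) * n - 15 * n - (11 * n + 1)) / p ≤ (if p ≤ 15 * n then 1 else 0 : ℤ) := ediv_le_ind hp0 (by push_cast; linarith) (by push_cast; linarith)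
  have t15 : ((41 : ℤ) * n - 14 * n - 13 * n) / p ≤ (if p ≤ 14 * n then 1 else 0 : ℤ) := ediv_le_ind hp0 (by push_cast; linarith) (by push_cast; linarith)
  have t16 : ((41 : ℤ) * n - 14 * n - 12 * n) / p ≤ (if p ≤ 15 * n then 1 else 0 : ℤ) := ediv_le_ind hp0 (by push_cast; linarith) (by push_cast; linarith)
  have t17 : ((41 : ℤ) * n - 14 * n - (11 * n + 1)) / p ≤ (if p ≤ 16 * n then 1 else 0 : ℤ) := ediv_le_ind hp0 (by push_cast; linarith) (by push_cast; linarith)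
  have t18 : ((41 : ℤ) * n - 13 * n - 12 * n) / p ≤ (if p ≤ 16 * n then 1 else 0 : ℤ) := ediv_le_ind hp0 (by push_cast; linarith) (by push_cast; linarith)
  have t19 : ((41 : ℤ) * n - 13 * n - (11 * n + 1)) / p ≤ (if p ≤ 17 * n then 1 else 0 : ℤ) := ediv_le_ind hp0 (by push_cast; linarith) (by push_cast; linarith)
  have t20 : ((41 : ℤ) * n - 12 * n - (11 * n + 1)) / p ≤ (if p ≤ 18 * n then 1 else 0 : ℤ) := ediv_le_ind hp0 (by push_cast; linarith) (by push_cast; linarith)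
  linarith

end Summit.KontsevichZagierPeriods.Zeta5Search.RecordRay
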